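/-
Copyright (c) 2026 the pub-hodgecm-mathlib formalisation cell (harness21).  Prover seat hodgecm-mathlib-A-p17 (g23), 2026-09-01.  P6 «MOD programme»,
sub-desk P6d, ★ sub-line `Cruxes/HLiu418/Lines/F0_P6d_FormalModuleKernels.lean` letter (HL-A) `HeightDichotomy` — the `q`-UPGRADE half (F0P6-p01 (g0) holds HL-A;
this file is his step (4), typed against an explicit interface).
-/
import Literature.RingTheory.FormalGroups.FormalGroupHeightKernel
import Mathlib.RingTheory.PowerSeries.Expand
import Mathlib.FieldTheory.Finite.Basic
import Mathlib.RingTheory.DiscreteValuationRing.Basic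
import Mathlib.RingTheory.LocalRing.ResidueField.Basic
import Mathlib.Algebra.Algebra.ZMod
import HarnessLib

/-!
# The `𝒪`-height of a formal `𝒪`-module law from a Frobenius form `[ϖ]_F = u(X^{p^r})`: `p^r` is a power of `q = #(𝒪∕ϖ)`
# (Fröhlich, *Formal Groups*, Ch. I §3 Thm. 2 — the `q`-upgrade; Harris–Taylor §II.1 p. 59)

Topic `Literature/RingTheory/FormalGroups`; namespace `Literature.RingTheory.FormalGroups`.  THEOREMS ONLY (no definition, no named fact, no instance, no
notation, no `sorry`); kernel lane `--supports stmt-HodgeConjecture-24832`.  Cell `hodgecm-mathlib`, P6 «MOD programme» (LEAD F0P6-plan (g0), sub-desk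
F0P6d-plan (g0)), ★ sub-line `Cruxes/HLiu418/Lines/F0_P6d_FormalModuleKernels.lean` (tree 3afe0ec0cb9e5ccd) letter (HL-A) `HeightDichotomy`, holder F0P6-p01 (g0)
(13:35:03Z; his steps (1)–(3) = «a nonzero endomorphism with vanishing differential over a field of characteristic `p` is `u(X^{p^r})`, `u(0) = 0`, `u′(0) ≠ 0`»);
this file is step (4): from that Frobenius form to ★ `FormalOModuleLaw.IsOfHeight M ϖ q h` with `q^h = p^r`, `h ≥ 1`.  Seat A-p17 (g23).
HONEST LABEL: HC_CM is proved only modulo the cell's 2 remaining named inputs (hLiu418, h413) until rung 0 closes; this file asserts nothing printed — it is the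
elementary `𝒪`-linearity computation.

THE MATHEMATICS [Frohlich1968 Ch. I §3 Thm. 2; HarrisTaylorAMS2001 §II.1 p. 59].  Let `𝒪` be a DVR with finite residue field `𝒪∕ϖ` of cardinality `q`, `k` a
field and an `𝒪`-algebra with `ϖ ↦ 0` (so `𝒪 → k` factors through an embedding `𝒪∕ϖ ↪ k`, and `char k = p`), `M` a formal `𝒪`-module law over `k` with
`[ϖ]_F(X) = u(X^{p^r})`, `u(0) = 0`, `c := u′(0) ≠ 0`.
* §1 `coeff_subst_eq_coeff_one_mul_of_X_pow_dvd` — if `X^N ∣ f` (`N ≥ 1`) and `g(0) = 0` then `[X^N] g(f) = g′(0)·[X^N] f` (only the linear term of `g` reaches degree `N`).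
* §2 **`pow_prime_pow_eq_self_of_act_eq_subst_X_pow`** — for every `a ∈ 𝒪` with image `ā ∈ k`: **`ā^{p^r} = ā`**.  Proof: `[a]∘[ϖ] = [ϖ]∘[a]` (★ `act_mul`, commutativity
  of `𝒪`); the degree-`p^r` coefficient of `[a]([ϖ](X))` is `ā·c` (§1 with `X^{p^r} ∣ [ϖ]`), that of `[ϖ]([a](X)) = u([a](X)^{p^r}) = u(([a]^{(p^r)})(X^{p^r}))` is
  `c·ā^{p^r}` (Frobenius in characteristic `p`: Mathlib `MvPowerSeries.map_iterateFrobenius_expand`; §1 with `N = 1`); cancel `c ≠ 0`.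
* §3 **`exists_isOfHeight_of_act_eq_subst_X_pow_prime_pow`** — hence `Frob^r = id` on the residue field `𝒪∕ϖ ↪ k` (a finite field with `q = p^f` elements), so
  `f ∣ r` (Mathlib `FiniteField.orderOf_frobeniusAlgHom`), `p^r = q^h` with `h = r∕f ≥ 1` (`r ≥ 1` because `[ϖ]′(0) = ϖ·1 = 0` in `k` while `u′(0) ≠ 0`), and
  `M.IsOfHeight ϖ q h` (★ p844456's normal form, `u′(0)` a unit of the field `k`).

## References
* [Frohlich1968] A. Fröhlich, *Formal Groups*, LNM 74 (1968): Ch. I §3 Thm. 2.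
* [HarrisTaylorAMS2001] M. Harris, R. Taylor, *The geometry and cohomology of some simple Shimura varieties* (2001): §II.1 p. 59.
* [Hazewinkel1978] M. Hazewinkel, *Formal Groups and Applications* (1978): §18.3 (height), §21.1 (formal `A`-modules).
-/

noncomputable section

namespace Literature.RingTheory.FormalGroups

universe u v

/-! ## §1 A coefficient lemma: only the linear term of `g` reaches degree `N` in `g(f)` when `X^N ∣ f` -/

section Coeff

variable {A : Type v} [CommRing A]

/-- If `X^N ∣ f` (`N ≠ 0`) and `g(0) = 0` then the degree-`N` coefficient of `g(f(X))` is `g′(0) · [X^N] f`: the term `g_d f^d` is divisible by `X^{dN}`,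
which exceeds degree `N` for `d ≥ 2`. [cite: Hazewinkel1978, §18.3] -/
theorem coeff_subst_eq_coeff_one_mul_of_X_pow_dvd {N : ℕ} (hN : N ≠ 0) {f g : PowerSeries A} (hf : (PowerSeries.X : PowerSeries A) ^ N ∣ f)
    (hg : PowerSeries.constantCoeff g = 0) :
    PowerSeries.coeff N (PowerSeries.subst f g) = PowerSeries.coeff 1 g * PowerSeries.coeff N f := by
  have hf0 : PowerSeries.constantCoeff f = 0 := by
    rw [← PowerSeries.coeff_zero_eq_constantCoeff_apply]; exact (PowerSeries.X_pow_dvd_iff.1 hf) 0 (Nat.pos_of_ne_zero hN)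
  have hfs : PowerSeries.HasSubst f := PowerSeries.HasSubst.of_constantCoeff_zero' hf0
  rw [PowerSeries.coeff_subst' hfs, finsum_eq_single _ 1 ?_]
  · rw [pow_one, smul_eq_mul]
  · intro d hd
    rcases Nat.lt_or_gt_of_ne hd with hd0 | hd2
    · rw [Nat.lt_one_iff.1 hd0, PowerSeries.coeff_zero_eq_constantCoeff_apply, hg, zero_smul]
    · have hdvd : (PowerSeries.X : PowerSeries A) ^ (N * d) ∣ f ^ d := by rw [pow_mul]; exact pow_dvd_pow_of_dvd hf d
      rw [(PowerSeries.X_pow_dvd_iff.1 hdvd) N (lt_mul_of_one_lt_right (Nat.pos_of_ne_zero hN) hd2), smul_zero]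

/-- `X^N ∣ u(X^N)` when `u(0) = 0` (`N ≠ 0`). [cite: Hazewinkel1978, §18.3] -/
theorem X_pow_dvd_subst_X_pow {N : ℕ} (hN : N ≠ 0) {u : PowerSeries A} (hu0 : PowerSeries.constantCoeff u = 0) :
    (PowerSeries.X : PowerSeries A) ^ N ∣ PowerSeries.subst ((PowerSeries.X : PowerSeries A) ^ N) u := by
  rw [PowerSeries.X_pow_dvd_iff]
  intro m hm
  rw [PowerSeries.coeff_subst_X_pow hN]
  split_ifs with h
  · obtain ⟨j, rfl⟩ := h
    rcases Nat.eq_zero_or_pos j with rfl | hj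
    · rw [mul_zero, Nat.zero_div, PowerSeries.coeff_zero_eq_constantCoeff_apply, hu0, map_zero]
    · exact absurd hm (not_lt.2 (Nat.le_mul_of_pos_right N hj))
  · rfl

end Coeff

/-! ## §2 The `𝒪`-linearity computation: `ā^{p^r} = ā` on the image of `𝒪` -/

namespace FormalOModuleLaw

variable {𝒪 : Type u} [CommRing 𝒪] {k : Type v} [Field k] [Algebra 𝒪 k] (p : ℕ) [Fact p.Prime] [CharP k p]

/-- **THE `q`-UPGRADE COMPUTATION**: if `[ϖ]_F(X) = u(X^{p^r})` with `u(0) = 0`, `u′(0) ≠ 0`, over a field `k` of characteristic `p`, then every `a ∈ 𝒪` has image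
`ā ∈ k` with `ā^{p^r} = ā` — compare the degree-`p^r` coefficients of `[a]([ϖ](X))` (`= ā·u′(0)`) and `[ϖ]([a](X)) = u(([a]^{(p^r)})(X^{p^r}))` (`= u′(0)·ā^{p^r}`),
equal by `aϖ = ϖa` (★ `act_mul`). [cite: Frohlich1968, Ch. I §3 Thm. 2] [cite: HarrisTaylorAMS2001, §II.1 p. 59] -/
theorem pow_prime_pow_eq_self_of_act_eq_subst_X_pow (M : FormalOModuleLaw 𝒪 k) (ϖ : 𝒪) {r : ℕ} {u : PowerSeries k}
    (hu0 : PowerSeries.constantCoeff u = 0) (hu1 : PowerSeries.coeff 1 u ≠ 0)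
    (hr : (M.act ϖ).toPowerSeries = PowerSeries.subst ((PowerSeries.X : PowerSeries k) ^ (p ^ r)) u) (a : 𝒪) :
    algebraMap 𝒪 k a ^ p ^ r = algebraMap 𝒪 k a := by
  have hp : p.Prime := Fact.out
  have hN : p ^ r ≠ 0 := pow_ne_zero r hp.ne_zero
  set f := (M.act ϖ).toPowerSeries with hf
  set g := (M.act a).toPowerSeries with hg
  have hg0 : PowerSeries.constantCoeff g = 0 := (M.act a).constantCoeff_eq_zero
  have hg1 : PowerSeries.coeff 1 g = algebraMap 𝒪 k a := M.coeff_one_act a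
  have hgs : PowerSeries.HasSubst g := (M.act a).hasSubst
  have hXN : PowerSeries.HasSubst ((PowerSeries.X : PowerSeries k) ^ (p ^ r)) := PowerSeries.HasSubst.X_pow hN
  -- `[a]∘[ϖ] = [ϖ]∘[a]`
  have hcomm : PowerSeries.subst f g = PowerSeries.subst g f := by
    rw [hf, hg, ← M.act_mul a ϖ, ← M.act_mul ϖ a, mul_comm]
  -- the degree-`p^r` coefficient of `[ϖ]` is `c = u′(0)`
  have hcN : PowerSeries.coeff (p ^ r) f = PowerSeries.coeff 1 u := by
    rw [hr, PowerSeries.coeff_subst_X_pow hN, if_pos (dvd_refl _), Nat.div_self (Nat.pos_of_ne_zero hN), Algebra.algebraMap_self, RingHom.id_apply]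
  -- LEFT: `[X^{p^r}] [a]([ϖ](X)) = ā · c`
  have hL : PowerSeries.coeff (p ^ r) (PowerSeries.subst f g) = algebraMap 𝒪 k a * PowerSeries.coeff 1 u := by
    rw [coeff_subst_eq_coeff_one_mul_of_X_pow_dvd hN (by rw [hr]; exact X_pow_dvd_subst_X_pow hN hu0) hg0, hg1, hcN]
  -- RIGHT: `[ϖ]([a](X)) = u([a](X)^{p^r}) = (u ∘ [a]^{(p^r)})(X^{p^r})`
  set v : PowerSeries k := PowerSeries.map (iterateFrobenius k p r) g with hv
  have hv0 : PowerSeries.constantCoeff v = 0 := by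
    rw [hv, ← PowerSeries.coeff_zero_eq_constantCoeff_apply, PowerSeries.coeff_map, PowerSeries.coeff_zero_eq_constantCoeff_apply, hg0, map_zero]
  have hv1 : PowerSeries.coeff 1 v = algebraMap 𝒪 k a ^ p ^ r := by rw [hv, PowerSeries.coeff_map, hg1, iterateFrobenius_def]
  have hvs : PowerSeries.HasSubst v := PowerSeries.HasSubst.of_constantCoeff_zero' hv0
  have hgN : g ^ p ^ r = PowerSeries.subst ((PowerSeries.X : PowerSeries k) ^ (p ^ r)) v := by
    rw [hv, ← PowerSeries.expand_apply, ← PowerSeries.map_expand]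
    exact (MvPowerSeries.map_iterateFrobenius_expand p hp.ne_zero g r).symm
  have hR : PowerSeries.coeff (p ^ r) (PowerSeries.subst g f) = PowerSeries.coeff 1 u * algebraMap 𝒪 k a ^ p ^ r := by
    rw [hr, PowerSeries.subst_comp_subst_apply hXN hgs, PowerSeries.subst_pow hgs, PowerSeries.subst_X hgs, hgN,
      ← PowerSeries.subst_comp_subst_apply hvs hXN, PowerSeries.coeff_subst_X_pow hN, if_pos (dvd_refl _), Nat.div_self (Nat.pos_of_ne_zero hN),
      Algebra.algebraMap_self, RingHom.id_apply,
      coeff_subst_eq_coeff_one_mul_of_X_pow_dvd one_ne_zero (by rw [pow_one]; exact PowerSeries.X_dvd_iff.2 hv0) hu0, hv1]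
  -- compare
  have h := hL.symm.trans (hcomm ▸ hR)
  rw [mul_comm] at h
  exact (mul_left_cancel₀ hu1 h).symm

end FormalOModuleLaw

/-! ## §3 From the Frobenius form to the `𝒪`-height -/

/-- A finite field `K₀` embedded in a field `k` of characteristic `p` on which `x ↦ x^{p^r}` is the identity has `p`-degree dividing `r`:
`Nat.card K₀ ^ h = p ^ r` for some `h` (Frobenius has order `[K₀ : 𝔽_p]`, Mathlib `FiniteField.orderOf_frobeniusAlgHom`). [cite: Frohlich1968, Ch. I §3 Thm. 2] -/
theorem exists_card_pow_eq_prime_pow_of_forall_pow_eq_self (K₀ : Type u) [Field K₀] [Finite K₀] (p : ℕ) [Fact p.Prime] [CharP K₀ p] {r : ℕ}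
    (h : ∀ x : K₀, x ^ p ^ r = x) : ∃ h : ℕ, Nat.card K₀ ^ h = p ^ r ∧ (r ≠ 0 → h ≠ 0) := by
  haveI := Fintype.ofFinite K₀
  letI : Algebra (ZMod p) K₀ := ZMod.algebra K₀ p
  have hord := FiniteField.orderOf_frobeniusAlgHom (ZMod p) K₀
  have hpow : FiniteField.frobeniusAlgHom (ZMod p) K₀ ^ r = 1 := by
    refine DFunLike.ext _ _ fun x => ?_
    rw [AlgHom.coe_pow, FiniteField.coe_frobeniusAlgHom, pow_iterate, ZMod.card, AlgHom.one_apply]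
    exact h x
  have hdvd : Module.finrank (ZMod p) K₀ ∣ r := hord ▸ orderOf_dvd_of_pow_eq_one hpow
  obtain ⟨h, hh⟩ := hdvd
  refine ⟨h, ?_, fun hr hh0 => hr (by rw [hh, hh0, mul_zero])⟩
  rw [Nat.card_eq_fintype_card, Module.card_eq_pow_finrank (K := ZMod p), ZMod.card, ← pow_mul, ← hh]

variable {𝒪 : Type u} [CommRing 𝒪] [IsDomain 𝒪] [IsDiscreteValuationRing 𝒪] {k : Type v} [Field k] [Algebra 𝒪 k]

/-- Over an `𝒪`-algebra field `k` with `ϖ ↦ 0` (`ϖ` a uniformiser), `𝒪 → k` descends to an embedding of the residue field: every `ā`, `a ∈ 𝒪`, is the image of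
the residue class of `a`, and a polynomial identity holding on all `ā` holds on the residue field. Here: `ā^{p^r} = ā` for all `a` gives `y^{p^r} = y` on `𝒪∕ϖ`.
[cite: Frohlich1968, Ch. I §3 Thm. 2] -/
theorem residueField_pow_eq_self_of_forall {ϖ : 𝒪} (hϖ : Irreducible ϖ) (hϖk : algebraMap 𝒪 k ϖ = 0) {n : ℕ}
    (h : ∀ a : 𝒪, algebraMap 𝒪 k a ^ n = algebraMap 𝒪 k a) :
    (∀ y : IsLocalRing.ResidueField 𝒪, y ^ n = y) ∧ ∃ ι : IsLocalRing.ResidueField 𝒪 →+* k, Function.Injective ι := by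
  -- `algebraMap 𝒪 k` is a local homomorphism: non-units lie in `(ϖ)` and map to `0`
  haveI : IsLocalHom (algebraMap 𝒪 k) := by
    refine ⟨fun a ha => ?_⟩
    by_contra hna
    have hmem : a ∈ IsLocalRing.maximalIdeal 𝒪 := hna
    rw [(IsDiscreteValuationRing.irreducible_iff_uniformizer ϖ).1 hϖ, Ideal.mem_span_singleton] at hmem
    obtain ⟨b, rfl⟩ := hmem
    rw [map_mul, hϖk, zero_mul] at ha
    exact not_isUnit_zero ha
  set ι := IsLocalRing.ResidueField.lift (algebraMap 𝒪 k) with hι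
  refine ⟨fun y => ?_, ι, ι.injective⟩
  obtain ⟨a, rfl⟩ := IsLocalRing.residue_surjective y
  apply ι.injective
  rw [map_pow, hι, IsLocalRing.ResidueField.lift_residue_apply]
  exact h a

/-- **The characteristic of `k` is a prime** (the one of the finite residue field `𝒪∕ϖ ↪ k`): supplies the `(p) [Fact p.Prime] [CharP k p]` binders of the
next theorem from the (HL-A) hypotheses alone (`p := ringChar k`). [cite: Frohlich1968, Ch. I §3 Thm. 2] -/
theorem exists_prime_charP_of_algebraMap_uniformizer_eq_zero [Finite (IsLocalRing.ResidueField 𝒪)] {ϖ : 𝒪} (hϖ : Irreducible ϖ)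
    (hϖk : algebraMap 𝒪 k ϖ = 0) : ∃ p : ℕ, p.Prime ∧ CharP k p := by
  obtain ⟨-, ι, hι⟩ := residueField_pow_eq_self_of_forall (k := k) hϖ hϖk (n := 1) (fun a => pow_one _)
  have hne : ringChar (IsLocalRing.ResidueField 𝒪) ≠ 0 := CharP.ringChar_ne_zero_of_finite (IsLocalRing.ResidueField 𝒪)
  haveI : CharP (IsLocalRing.ResidueField 𝒪) (ringChar (IsLocalRing.ResidueField 𝒪)) := ringChar.charP _
  refine ⟨ringChar (IsLocalRing.ResidueField 𝒪), (CharP.char_is_prime_or_zero (IsLocalRing.ResidueField 𝒪) _).resolve_right hne,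
    (RingHom.charP_iff ι hι _).1 inferInstance⟩

/-- **THE `𝒪`-HEIGHT FROM A FROBENIUS FORM** (step (4) of (HL-A) `HeightDichotomy`): `𝒪` a DVR with finite residue field of cardinality `q`, `ϖ` a uniformiser,
`k` a field and `𝒪`-algebra with `ϖ ↦ 0`, of characteristic `p`; if `[ϖ]_F(X) = u(X^{p^r})` with `u(0) = 0`, `u′(0) ≠ 0`, then `M` has `𝒪`-height `h ≥ 1` with
`q^h = p^r` (★ `FormalOModuleLaw.IsOfHeight M ϖ q h`).  With F0P6-p01 (g0)'s steps (1)–(3) this closes `stub_HLA`. [cite: Frohlich1968, Ch. I §3 Thm. 2]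
[cite: HarrisTaylorAMS2001, §II.1 p. 59] -/
theorem FormalOModuleLaw.exists_isOfHeight_of_act_eq_subst_X_pow_prime_pow [Finite (IsLocalRing.ResidueField 𝒪)] (ϖ : 𝒪) (hϖ : Irreducible ϖ)
    (hϖk : algebraMap 𝒪 k ϖ = 0) (p : ℕ) [Fact p.Prime] [CharP k p] (M : FormalOModuleLaw 𝒪 k) {r : ℕ} {u : PowerSeries k}
    (hu0 : PowerSeries.constantCoeff u = 0) (hu1 : PowerSeries.coeff 1 u ≠ 0)
    (hr : (M.act ϖ).toPowerSeries = PowerSeries.subst ((PowerSeries.X : PowerSeries k) ^ (p ^ r)) u) :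
    ∃ h, 0 < h ∧ M.IsOfHeight ϖ (Nat.card (IsLocalRing.ResidueField 𝒪)) h := by
  have hp : p.Prime := Fact.out
  have hN : p ^ r ≠ 0 := pow_ne_zero r hp.ne_zero
  -- `r ≠ 0`: the linear coefficient of `[ϖ]` is `ϖ·1 = 0`, that of `u(X)` is `u′(0) ≠ 0`
  have hr0 : r ≠ 0 := by
    rintro rfl
    have h1 : PowerSeries.coeff 1 (M.act ϖ).toPowerSeries = 0 := by rw [M.coeff_one_act, hϖk]
    rw [hr, pow_zero, PowerSeries.coeff_subst_X_pow one_ne_zero, if_pos (dvd_refl _), Nat.div_one, Algebra.algebraMap_self, RingHom.id_apply] at h1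
    exact hu1 h1
  -- `ā^{p^r} = ā` on the image of `𝒪`, hence on the residue field
  have hfix := FormalOModuleLaw.pow_prime_pow_eq_self_of_act_eq_subst_X_pow p M ϖ hu0 hu1 hr
  obtain ⟨hres, ι, hι⟩ := residueField_pow_eq_self_of_forall hϖ hϖk hfix
  haveI : CharP (IsLocalRing.ResidueField 𝒪) p := (RingHom.charP_iff ι hι p).2 inferInstance
  obtain ⟨h, hh, hh0⟩ := exists_card_pow_eq_prime_pow_of_forall_pow_eq_self (IsLocalRing.ResidueField 𝒪) p hres
  refine ⟨h, Nat.pos_of_ne_zero (hh0 hr0), u, hu0, isUnit_iff_ne_zero.2 hu1, ?_⟩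
  rw [hh]; exact hr

end Literature.RingTheory.FormalGroups

end
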